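import Summits.QuantumFields.BalabanUV.Beta.EriceFlowEnclosureB12AsPrintedHistoryUniformDepth

/-!
# Beta / EriceFlowEnclosureB12AsPrintedHistoryContagionMemoryFold — MEMORY FOLDS EARLIER THAN MARKOV: without a reference run, coupling-chart
# history moduli with fading memory θ = ½ and `Cγ³ = 3∕2 < 2` — BELOW row U's Markov fold threshold — already admit two bare couplings with
# same-depth runs meeting after TWO steps (and then, along an anti-free tail, at K^{−1∕2} → 0): the age-0 and age-1 feedbacks of the discrepancy
# interfere destructively.  A fifth witness for the AF contagion's «the reference run is load-bearing» (`…HistoryContagionSharp`), and a data point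
# for the open threshold of REFERENCE-FREE uniqueness between prover 2's sufficient `4Cγ³ ≤ (1 − θ)²` (gen 44 `…PointwiseFadingOrder`) and the
# Markov value 2 (β-flow team, prover 1 = recursion ∕ upper ∕ bare-coupling ∕ UNIQUENESS side, unit `b2b-balaban-beta-bflow-p1`, gen 35; ROW AP-I·Uc)

HONEST FRAMING (page 1 of everything the β sub-cell writes): discharging `BetaPertH` makes Bałaban's UV stability UNCONDITIONAL — a
real constructive-QFT result; it is NOT the continuum limit and NOT the Clay problem.  HONEST DEPENDENCY (cell reorg 2026-08-19,
verbatim): «continuum YM on T⁴ ⇐ BetaPertH ∧ nine spine estimates (0/9 proved); BetaPertH ⇐ (D1) ∧ (D4) ∧ CAP+tail; G-an2-4 gates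
asym, D1 and NE2/3/4.»  THIS MODULE DISCHARGES NOTHING: ONE WITNESS FAMILY OF OURS for a history-dependent β of the printed recursion (0.20)
of [I] = T. Bałaban, Commun. Math. Phys. **109** (1987) [Balaban1987RG1] (p. 298: β_j *"depends also on all preceding coupling constants"*) under
node U2's HYPOTHESIS SHAPES `T4CouplingMatching.HistLipschitz ∕ FadingMemory` (NOT printed), wrapped in a `Setting` whose other fields are junk
(only `S.β` is read, as in gen 34's #62d).  Nothing of Bałaban's β is asserted.

THE POINT.  For a MARKOV family (β_{l+1} a function of the last coupling only) the one-step map x ↦ x − φ(x^{−1∕2}) is injective as long as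
|φ′|·s³ < 2 — row U's x-modulus (#22 `…TunedFlow`), the coupling-chart form of which is `Cγ³ < 2`; part 4's fold (`…HistoryContagionSharp.noReference_twoRuns`)
sits at Cγ³ = 6.  WITH MEMORY the two-step map can degenerate although every one-step map is injective: in the chart x = 1∕g², take
β₁ = ½(x₀ − 1) and β₂ = ½[(x₁ − 1) + ½(x₀ − 1)] (dependence on the older coupling at HALF the weight: fading rate θ = ½); then
x₁ = ½(x₀ + 1) and x₂ = x₁ − ½(x₁ − 1) − ¼(x₀ − 1) = 1 for EVERY x₀ — the feedback through x₁ and the direct memory of x₀ cancel.  Cut off at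
x ≤ 100∕81 (couplings ≥ 9∕10) to make the family Lipschitz in the COUPLING chart on the whole box ]0, 1]: ψ(s) = min(1∕s², 100∕81) has
|ψ(s) − ψ(t)| ≤ 3|s − t| there (§1 `psi_lipschitz`; the sharp constant is 2·(10∕9)³ ≈ 2.74), so β₁(p) = ½(ψ(p₀) − 1), β₂(p) = ½(ψ(p₁) − 1) + ¼(ψ(p₀) − 1)
carry `HistLipschitz Λ 1` with Λ 0 0 = Λ 1 1 = 3∕2, Λ 1 0 = 3∕4, i.e. `FadingMemory (3∕2) (1∕2) Λ` — **Cγ³ = 3∕2 < 2** — and the runs x = (1, 1, 1) and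
x′ = (100∕81, 181∕162, 1), i.e. g = (1, 1, 1), g′ = (9∕10, (162∕181)^{1∕2}, 1): same depth, box ]0, 1], SAME coupling after two steps, DIFFERENT bare couplings;
continued by the anti-free tail β_{l+1} ≡ −1 (l ≥ 2) both reach K^{−1∕2}-type endpoints (K − 1)^{−1∕2} → 0 (§2 `memoryFold_twoRuns`).  Hence (§2
**`no_threshold_without_reference_belowMarkov`**): part 4's «no endpoint threshold from the moduli alone» survives the extra hypothesis `Cγ³ ≤ 3∕2`
(and θ = ½): the threshold of reference-free uniqueness at fading rate ½ lies in [1∕16, 3∕2[ (prover 2's `(1 − θ)²∕4` ≤ · < this witness), strictly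
below the Markov value.  With a reference run (parts 2∕3) no such threshold is needed at all.

WHAT THIS FILE PROVES (0 sorry, 0 def): §1 `psi_lipschitz`; §2 **`memoryFold_twoRuns`**, **`no_threshold_without_reference_belowMarkov`**.
NOT CLAIMED: any modulus, sign or bound for Bałaban's β; the sharp threshold; Theorem 2; `BetaPertH`; continuum; Clay.
-/

namespace Summit.QuantumFields.BalabanUV.Beta.EriceFlowEnclosureB12AsPrintedHistoryContagionMemoryFold

open Finset
open Literature.MathematicalPhysics.QuantumFieldTheory.Balaban1983to89
open Literature.MathematicalPhysics.QuantumFieldTheory.Balaban1983to89.B12BetaAsPrinted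
open Literature.MathematicalPhysics.QuantumFieldTheory.Balaban1983to89.FlowStep (HBeta prefixOf Box mem_box RGEqH)
open Literature.MathematicalPhysics.QuantumFieldTheory.Balaban1983to89.T4CouplingMatching (HistLipschitz FadingMemory)

noncomputable section

/-! ## §1 The cut-off chart change is Lipschitz in the coupling -/

/-- One-sided core: for `9∕10 ≤ s ≤ t ≤ 1`, `1∕s² − 1∕t² ≤ 3(t − s)`. [folklore] -/
theorem inv_sq_sub_le {s t : ℝ} (hs : 9 / 10 ≤ s) (hst : s ≤ t) (ht1 : t ≤ 1) :
    1 / s ^ 2 - 1 / t ^ 2 ≤ 3 * (t - s) := by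
  have hs0 : 0 < s := by linarith
  have ht0 : 0 < t := by linarith
  have e : 1 / s ^ 2 - 1 / t ^ 2 = (t - s) * ((t + s) / (s ^ 2 * t ^ 2)) := by
    field_simp
    ring
  rw [e]
  have hq : (t + s) / (s ^ 2 * t ^ 2) ≤ 3 := by
    rw [div_le_iff₀ (by positivity)]
    have h1 : (9 / 10 : ℝ) * ((9 / 10) * (9 / 10)) ≤ s * (t * t) :=
      mul_le_mul hs (mul_le_mul (hs.trans hst) (hs.trans hst) (by norm_num) ht0.le) (by norm_num) hs0.le
    have h2 : (9 / 10 : ℝ) * ((9 / 10) * (9 / 10)) ≤ t * (s * s) :=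
      mul_le_mul (hs.trans hst) (mul_le_mul hs hs (by norm_num) hs0.le) (by norm_num) ht0.le
    nlinarith
  nlinarith [mul_le_mul_of_nonneg_left hq (sub_nonneg.mpr hst)]

/-- Mixed core: for `9∕10 ≤ t`, `100∕81 − 1∕t² ≤ 3(t − 9∕10)` (the cut-off value against the chart; tangent at t = 9∕10). [folklore] -/
theorem cutoff_sub_le {t : ℝ} (ht : 9 / 10 ≤ t) : 100 / 81 - 1 / t ^ 2 ≤ 3 * (t - 9 / 10) := by
  have ht0 : 0 < t := by linarith
  have hq : 0 ≤ 3 * t ^ 2 - 100 / 81 * t - 10 / 9 := by nlinarith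
  have key : 0 ≤ (t - 9 / 10) * (3 * t ^ 2 - 100 / 81 * t - 10 / 9) := mul_nonneg (by linarith) hq
  have ht2 : 0 < t ^ 2 := by positivity
  have h2 : (100 / 81 - 3 * (t - 9 / 10)) * t ^ 2 ≤ 1 := by nlinarith [key]
  have h3 : 100 / 81 - 3 * (t - 9 / 10) ≤ 1 / t ^ 2 := by rw [le_div_iff₀ ht2]; exact h2
  linarith

/-- Above the cut-off coupling the chart is below the cut-off value: `9∕10 ≤ u ⟹ 1∕u² ≤ 100∕81`. [folklore] -/
theorem inv_sq_le_cut {u : ℝ} (hu : 9 / 10 ≤ u) : 1 / u ^ 2 ≤ 100 / 81 := by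
  rw [div_le_div_iff₀ (by positivity) (by norm_num)]
  nlinarith [mul_le_mul hu hu (by norm_num) (by linarith)]

/-- Below the cut-off coupling the chart is above the cut-off value: `0 < u ≤ 9∕10 ⟹ 100∕81 ≤ 1∕u²`. [folklore] -/
theorem cut_le_inv_sq {u : ℝ} (hu0 : 0 < u) (hu : u ≤ 9 / 10) : 100 / 81 ≤ 1 / u ^ 2 := by
  rw [div_le_div_iff₀ (by norm_num) (by positivity)]
  nlinarith [mul_le_mul hu hu hu0.le (by norm_num)]

/-- **The cut-off chart change `ψ(s) = min(1∕s², 100∕81)` is 3-Lipschitz on ]0, 1].**  (Sharp constant 2·(10∕9)³ ≈ 2.74; four cases on the position of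
s, t against the cut-off coupling 9∕10: `cut_le_inv_sq` ∕ `inv_sq_le_cut` decide the `min`, `inv_sq_sub_le` ∕ `cutoff_sub_le` bound it.) [folklore] -/
theorem psi_lipschitz {s t : ℝ} (hs0 : 0 < s) (hs1 : s ≤ 1) (ht0 : 0 < t) (ht1 : t ≤ 1) :
    |min (1 / s ^ 2) (100 / 81) - min (1 / t ^ 2) (100 / 81)| ≤ 3 * |s - t| := by
  rcases le_or_gt s (9 / 10) with hs9 | hs9 <;> rcases le_or_gt t (9 / 10) with ht9 | ht9
  · rw [min_eq_right (cut_le_inv_sq hs0 hs9), min_eq_right (cut_le_inv_sq ht0 ht9), sub_self, abs_zero]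
    positivity
  · rw [min_eq_right (cut_le_inv_sq hs0 hs9), min_eq_left (inv_sq_le_cut ht9.le),
      abs_of_nonneg (by linarith [inv_sq_le_cut ht9.le]), abs_of_nonpos (by linarith), neg_sub]
    linarith [cutoff_sub_le ht9.le]
  · rw [min_eq_left (inv_sq_le_cut hs9.le), min_eq_right (cut_le_inv_sq ht0 ht9),
      abs_of_nonpos (by linarith [inv_sq_le_cut hs9.le]), abs_of_nonneg (by linarith), neg_sub]
    linarith [cutoff_sub_le hs9.le]
  · rw [min_eq_left (inv_sq_le_cut hs9.le), min_eq_left (inv_sq_le_cut ht9.le)]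
    rcases le_or_gt s t with hst | hts
    · have hmono : 1 / t ^ 2 ≤ 1 / s ^ 2 := one_div_le_one_div_of_le (by positivity) (pow_le_pow_left₀ hs0.le hst 2)
      rw [abs_of_nonneg (by linarith), abs_of_nonpos (by linarith), neg_sub]
      exact inv_sq_sub_le hs9.le hst ht1
    · have hmono : 1 / s ^ 2 ≤ 1 / t ^ 2 := one_div_le_one_div_of_le (by positivity) (pow_le_pow_left₀ ht0.le hts.le 2)
      rw [abs_of_nonpos (by linarith), abs_of_nonneg (by linarith), neg_sub]
      exact inv_sq_sub_le ht9.le hts.le hs1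

/-! ## §2 The memory fold: two runs meeting after two steps, below the Markov threshold -/

/-- **THE MEMORY FOLD.**  For every depth K ≥ 2: the family β₁(p) = ½(ψ(p₀) − 1), β₂(p) = ½(ψ(p₁) − 1) + ¼(ψ(p₀) − 1), β_{l+1} ≡ −1 (l ≥ 2), with ψ(s) =
min(1∕s², 100∕81), carries `HistLipschitz Λ 1` with Λ 0 0 = Λ 1 1 = 3∕2, Λ 1 0 = 3∕4, Λ = 0 otherwise — `FadingMemory (3∕2) (1∕2) Λ`, so **Cγ³ = 3∕2 < 2**
(below the Markov fold threshold) — and has the two runs g = (1, 1, 1, 2^{−1∕2}, …, (K − 1)^{−1∕2}) and g′ = (9∕10, (162∕181)^{1∕2}, 1, 2^{−1∕2}, …, (K − 1)^{−1∕2}) of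
(0.20): same depth, all couplings in ]0, 1], EQUAL FROM SCALE 2 ON (in the chart x = 1∕g²: x′ = (100∕81, 181∕162, 1, 2, …): x₂ = x₁ − ½(x₁ − 1) − ¼(x₀ − 1) = 1 for
every x₀ in the cut-off window), DIFFERENT bare couplings.  A family of OURS in a junk `Setting`. [cite: Balaban1987RG1, (0.20) p.256 with p.298] -/
theorem memoryFold_twoRuns (K : ℕ) (hK : 2 ≤ K) :
    ∃ (S : Setting) (Λ : ℕ → ℕ → ℝ) (g g' : ℕ → ℝ),
      HistLipschitz Λ 1 S.β ∧ FadingMemory (3 / 2) (1 / 2) Λ ∧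
      RGEqH K S.β g ∧ RGEqH K S.β g' ∧
      (∀ i, i ≤ K → 0 < g i ∧ g i ≤ 1) ∧ (∀ i, i ≤ K → 0 < g' i ∧ g' i ≤ 1) ∧
      g K = g' K ∧ g K = 1 / Real.sqrt ((K : ℝ) - 1) ∧ g 0 ≠ g' 0 := by
  -- the cut-off chart change, the family and its modulus
  let ψ : ℝ → ℝ := fun s => min (1 / s ^ 2) (100 / 81)
  let β : HBeta := fun l p =>
    if l = 0 then (ψ (p 0) - 1) / 2 else if l = 1 then (ψ (p (Fin.last l)) - 1) / 2 + (ψ (p 0) - 1) / 4 else -1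
  let Λ : ℕ → ℕ → ℝ := fun l i => if l = 0 then 3 / 2 else if l = 1 then (if i = 1 then 3 / 2 else 3 / 4) else 0
  -- the two runs
  let g : ℕ → ℝ := fun i => if i ≤ 1 then 1 else 1 / Real.sqrt ((i : ℝ) - 1)
  let g' : ℕ → ℝ := fun i => if i = 0 then 9 / 10 else if i = 1 then 1 / Real.sqrt (181 / 162) else 1 / Real.sqrt ((i : ℝ) - 1)
  -- values of ψ along the runs
  have hψ1 : ψ 1 = 1 := by
    show min (1 / (1 : ℝ) ^ 2) (100 / 81) = 1
    norm_num
  have hψ0' : ψ (9 / 10) = 100 / 81 := by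
    show min (1 / (9 / 10 : ℝ) ^ 2) (100 / 81) = 100 / 81
    norm_num
  have hsq181 : (1 / Real.sqrt (181 / 162)) ^ 2 = 162 / 181 := by
    rw [one_div_pow, Real.sq_sqrt (by norm_num)]
    norm_num
  have hψ1' : ψ (1 / Real.sqrt (181 / 162)) = 181 / 162 := by
    show min (1 / (1 / Real.sqrt (181 / 162)) ^ 2) (100 / 81) = 181 / 162
    rw [hsq181]
    norm_num
  have hsqrt_tail : ∀ k : ℕ, 2 ≤ k → 1 / (1 / Real.sqrt ((k : ℝ) - 1)) ^ 2 = (k : ℝ) - 1 := by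
    intro k hk
    have hk1 : (1 : ℝ) ≤ (k : ℝ) - 1 := by
      have : (2 : ℝ) ≤ k := by exact_mod_cast hk
      linarith
    rw [one_div_pow, one_div_one_div, Real.sq_sqrt (by linarith)]
  refine ⟨⟨13, True, 1, fun P _ => P.g0, β, 1, 1, 1, fun _ => Unit, fun _ => (), fun _ _ => 0, fun _ _ _ => 0, fun _ _ _ => 0,
      fun _ _ _ => True, 1, 1, 1, fun _ => 1, fun _ _ => fun _ _ _ => 0, fun _ _ => fun _ _ _ => 0, 1, fun _ _ => True, 1, True,
      fun _ _ => 0, 1, 1, 1, 1⟩, Λ, g, g', ?_, ?_, ?_, ?_, ?_, ?_, ?_, ?_, ?_⟩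
  · -- HistLipschitz Λ 1 β
    intro k p q hp hq
    have hp' := mem_box.mp hp
    have hq' := mem_box.mp hq
    by_cases hk0 : k = 0
    · subst hk0
      have h0 := psi_lipschitz (hp' 0).1 (hp' 0).2 (hq' 0).1 (hq' 0).2
      show |((ψ (p 0) - 1) / 2) - ((ψ (q 0) - 1) / 2)| ≤ ∑ i : Fin 1, (3 / 2 : ℝ) * |p i - q i|
      rw [Fin.sum_univ_one, show ((ψ (p 0) - 1) / 2) - ((ψ (q 0) - 1) / 2) = (ψ (p 0) - ψ (q 0)) / 2 by ring, abs_div,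
        abs_of_pos (by norm_num : (0 : ℝ) < 2)]
      linarith
    by_cases hk1 : k = 1
    · subst hk1
      have h0 := psi_lipschitz (hp' 0).1 (hp' 0).2 (hq' 0).1 (hq' 0).2
      have h1 := psi_lipschitz (hp' (Fin.last 1)).1 (hp' (Fin.last 1)).2 (hq' (Fin.last 1)).1 (hq' (Fin.last 1)).2
      show |((ψ (p (Fin.last 1)) - 1) / 2 + (ψ (p 0) - 1) / 4) - ((ψ (q (Fin.last 1)) - 1) / 2 + (ψ (q 0) - 1) / 4)|
        ≤ ∑ i : Fin 2, (if (1 : ℕ) = 0 then (3 / 2 : ℝ) else if (1 : ℕ) = 1 then (if (i : ℕ) = 1 then 3 / 2 else 3 / 4) else 0) * |p i - q i|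
      rw [Fin.sum_univ_two]
      simp only [Nat.one_ne_zero, if_false, if_true, Fin.val_zero, Fin.val_one, zero_ne_one]
      have e : ((ψ (p (Fin.last 1)) - 1) / 2 + (ψ (p 0) - 1) / 4) - ((ψ (q (Fin.last 1)) - 1) / 2 + (ψ (q 0) - 1) / 4)
          = (ψ (p (Fin.last 1)) - ψ (q (Fin.last 1))) / 2 + (ψ (p 0) - ψ (q 0)) / 4 := by ring
      rw [e]
      refine (abs_add_le _ _).trans ?_
      rw [abs_div, abs_div, abs_of_pos (by norm_num : (0 : ℝ) < 2), abs_of_pos (by norm_num : (0 : ℝ) < 4)]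
      have hlast : (Fin.last 1 : Fin 2) = 1 := rfl
      rw [hlast] at h1 ⊢
      linarith
    · show |(if k = 0 then (ψ (p 0) - 1) / 2 else if k = 1 then (ψ (p (Fin.last k)) - 1) / 2 + (ψ (p 0) - 1) / 4 else -1)
          - (if k = 0 then (ψ (q 0) - 1) / 2 else if k = 1 then (ψ (q (Fin.last k)) - 1) / 2 + (ψ (q 0) - 1) / 4 else -1)|
        ≤ ∑ i : Fin (k + 1), (if k = 0 then (3 / 2 : ℝ) else if k = 1 then (if (i : ℕ) = 1 then 3 / 2 else 3 / 4) else 0) * |p i - q i|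
      simp only [hk0, hk1, if_false, sub_self, abs_zero, zero_mul, Finset.sum_const_zero, le_refl]
  · -- FadingMemory (3/2) (1/2) Λ
    intro k i hik
    by_cases hk0 : k = 0
    · subst hk0
      have hi : i = 0 := by omega
      subst hi
      norm_num [Λ]
    by_cases hk1 : k = 1
    · subst hk1
      rcases Nat.le_one_iff_eq_zero_or_eq_one.mp hik with hi | hi
      · subst hi; norm_num [Λ]
      · subst hi; norm_num [Λ]
    · simp only [Λ, hk0, hk1, if_false]
      exact ⟨le_rfl, by positivity⟩
  · -- RGEqH K β g
    intro k hk
    by_cases hk0 : k = 0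
    · subst hk0
      show 1 / (if 0 ≤ 1 then (1 : ℝ) else 1 / Real.sqrt ((0 : ℕ) - 1 : ℝ)) ^ 2
        = 1 / (if 0 + 1 ≤ 1 then (1 : ℝ) else 1 / Real.sqrt (((0 + 1 : ℕ) : ℝ) - 1)) ^ 2 + (if (0 : ℕ) = 0 then (ψ (prefixOf g 0 0) - 1) / 2
          else if (0 : ℕ) = 1 then (ψ (prefixOf g 0 (Fin.last 0)) - 1) / 2 + (ψ (prefixOf g 0 0) - 1) / 4 else -1)
      simp only [FlowStep.prefixOf_apply, Fin.val_zero]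
      simp [g, hψ1]
    by_cases hk1 : k = 1
    · subst hk1
      show 1 / (if 1 ≤ 1 then (1 : ℝ) else 1 / Real.sqrt ((1 : ℕ) - 1 : ℝ)) ^ 2
        = 1 / (if 1 + 1 ≤ 1 then (1 : ℝ) else 1 / Real.sqrt (((1 + 1 : ℕ) : ℝ) - 1)) ^ 2 + (if (1 : ℕ) = 0 then (ψ (prefixOf g 1 0) - 1) / 2
          else if (1 : ℕ) = 1 then (ψ (prefixOf g 1 (Fin.last 1)) - 1) / 2 + (ψ (prefixOf g 1 0) - 1) / 4 else -1)
      simp only [FlowStep.prefixOf_apply, Fin.val_zero, Fin.val_last]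
      norm_num [g, hψ1]
    · have hk2 : 2 ≤ k := by omega
      show 1 / (if k ≤ 1 then (1 : ℝ) else 1 / Real.sqrt ((k : ℝ) - 1)) ^ 2
        = 1 / (if k + 1 ≤ 1 then (1 : ℝ) else 1 / Real.sqrt (((k + 1 : ℕ) : ℝ) - 1)) ^ 2 + (if k = 0 then (ψ (prefixOf g k 0) - 1) / 2
          else if k = 1 then (ψ (prefixOf g k (Fin.last k)) - 1) / 2 + (ψ (prefixOf g k 0) - 1) / 4 else -1)
      rw [if_neg (by omega), if_neg (by omega), if_neg hk0, if_neg hk1, hsqrt_tail k hk2, hsqrt_tail (k + 1) (by omega)]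
      push_cast
      ring
  · -- RGEqH K β g'
    intro k hk
    by_cases hk0 : k = 0
    · subst hk0
      show 1 / (if (0 : ℕ) = 0 then (9 / 10 : ℝ) else if (0 : ℕ) = 1 then 1 / Real.sqrt (181 / 162) else 1 / Real.sqrt ((0 : ℕ) - 1 : ℝ)) ^ 2
        = 1 / (if (0 + 1 : ℕ) = 0 then (9 / 10 : ℝ) else if (0 + 1 : ℕ) = 1 then 1 / Real.sqrt (181 / 162) else 1 / Real.sqrt (((0 + 1 : ℕ) : ℝ) - 1)) ^ 2
          + (if (0 : ℕ) = 0 then (ψ (prefixOf g' 0 0) - 1) / 2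
          else if (0 : ℕ) = 1 then (ψ (prefixOf g' 0 (Fin.last 0)) - 1) / 2 + (ψ (prefixOf g' 0 0) - 1) / 4 else -1)
      simp only [FlowStep.prefixOf_apply, Fin.val_zero, if_true, Nat.zero_add, Nat.one_ne_zero, if_false]
      rw [hsq181]
      simp only [g', if_true, hψ0']
      norm_num
    by_cases hk1 : k = 1
    · subst hk1
      show 1 / (if (1 : ℕ) = 0 then (9 / 10 : ℝ) else if (1 : ℕ) = 1 then 1 / Real.sqrt (181 / 162) else 1 / Real.sqrt ((1 : ℕ) - 1 : ℝ)) ^ 2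
        = 1 / (if (1 + 1 : ℕ) = 0 then (9 / 10 : ℝ) else if (1 + 1 : ℕ) = 1 then 1 / Real.sqrt (181 / 162) else 1 / Real.sqrt (((1 + 1 : ℕ) : ℝ) - 1)) ^ 2
          + (if (1 : ℕ) = 0 then (ψ (prefixOf g' 1 0) - 1) / 2
          else if (1 : ℕ) = 1 then (ψ (prefixOf g' 1 (Fin.last 1)) - 1) / 2 + (ψ (prefixOf g' 1 0) - 1) / 4 else -1)
      simp only [FlowStep.prefixOf_apply, Fin.val_zero, Fin.val_last, if_true, Nat.one_ne_zero, if_false,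
        show (1 + 1 : ℕ) ≠ 0 by omega, show (1 + 1 : ℕ) ≠ 1 by omega]
      rw [hsq181, hsqrt_tail (1 + 1) le_rfl]
      simp only [g', if_true, Nat.one_ne_zero, if_false, hψ0', hψ1']
      push_cast
      norm_num
    · have hk2 : 2 ≤ k := by omega
      show 1 / (if k = 0 then (9 / 10 : ℝ) else if k = 1 then 1 / Real.sqrt (181 / 162) else 1 / Real.sqrt ((k : ℝ) - 1)) ^ 2
        = 1 / (if k + 1 = 0 then (9 / 10 : ℝ) else if k + 1 = 1 then 1 / Real.sqrt (181 / 162) else 1 / Real.sqrt (((k + 1 : ℕ) : ℝ) - 1)) ^ 2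
          + (if k = 0 then (ψ (prefixOf g' k 0) - 1) / 2
          else if k = 1 then (ψ (prefixOf g' k (Fin.last k)) - 1) / 2 + (ψ (prefixOf g' k 0) - 1) / 4 else -1)
      rw [if_neg hk0, if_neg hk1, if_neg (by omega), if_neg (by omega), if_neg hk0, if_neg hk1, hsqrt_tail k hk2,
        hsqrt_tail (k + 1) (by omega)]
      push_cast
      ring
  · -- g in ]0, 1]
    intro i hi
    by_cases hi1 : i ≤ 1
    · simp [g, hi1]
    · have hi2 : (2 : ℝ) ≤ i := by exact_mod_cast (show 2 ≤ i by omega)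
      simp only [g, hi1, if_false]
      have hpos : 0 < Real.sqrt ((i : ℝ) - 1) := Real.sqrt_pos.mpr (by linarith)
      refine ⟨by positivity, ?_⟩
      rw [div_le_one hpos]
      exact Real.one_le_sqrt.mpr (by linarith)
  · -- g' in ]0, 1]
    intro i hi
    by_cases hi0 : i = 0
    · subst hi0; norm_num [g']
    by_cases hi1 : i = 1
    · subst hi1
      simp only [g', Nat.one_ne_zero, if_false, if_true]
      have hpos : 0 < Real.sqrt (181 / 162 : ℝ) := Real.sqrt_pos.mpr (by norm_num)
      refine ⟨by positivity, ?_⟩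
      rw [div_le_one hpos]
      exact Real.one_le_sqrt.mpr (by norm_num)
    · have hi2 : (2 : ℝ) ≤ i := by exact_mod_cast (show 2 ≤ i by omega)
      simp only [g', hi0, hi1, if_false]
      have hpos : 0 < Real.sqrt ((i : ℝ) - 1) := Real.sqrt_pos.mpr (by linarith)
      refine ⟨by positivity, ?_⟩
      rw [div_le_one hpos]
      exact Real.one_le_sqrt.mpr (by linarith)
  · -- same endpoint
    have hK0 : K ≠ 0 := by omega
    have hK1 : K ≠ 1 := by omega
    have hKle : ¬ K ≤ 1 := by omega
    simp [g, g', hK0, hK1, hKle]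
  · have hKle : ¬ K ≤ 1 := by omega
    simp [g, hKle]
  · -- different bare couplings
    norm_num [g, g']

/-- **NO ENDPOINT THRESHOLD FROM THE MODULI ALONE — EVEN BELOW THE MARKOV FOLD THRESHOLD.**  Part 4's `no_threshold_without_reference` with the extra hypotheses
`Cγ³ ≤ 3∕2` (< 2, row U's Markov fold threshold in the coupling chart) and θ = ½ STILL holds: there is NO function e₀(C, θ, γ) > 0 making two same-depth runs of
(0.20) in ]0, γ] under `HistLipschitz Λ γ S.β`, `FadingMemory C θ Λ`, `Cγ³ ≤ 3∕2`, pinned at a common endpoint ≤ e₀, coincide — by `memoryFold_twoRuns` at C = 3∕2, θ = ½,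
γ = 1 and depth K ≥ 1 + 1∕e₀².  So the threshold of REFERENCE-FREE uniqueness at fading rate ½ lies in [1∕16, 3∕2[: prover 2's sufficient `4Cγ³ ≤ (1 − θ)²`
(`…PointwiseFadingOrder`, gen 44) below, this memory fold above — strictly under the Markov value 2; with ONE reference run (parts 2∕3) no threshold is needed.
[cite: Balaban1987RG1, Thm 2 p.259 («g₀ = g₀(ε, g)») with (0.20) p.256 and p.298] -/
theorem no_threshold_without_reference_belowMarkov :
    ¬ (∃ e₀ : ℝ → ℝ → ℝ → ℝ, (∀ C θ γ : ℝ, 0 < C → 0 < θ → θ < 1 → 0 < γ → 0 < e₀ C θ γ) ∧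
        ∀ (S : Setting) (γ C θ : ℝ) (Λ : ℕ → ℕ → ℝ) (K : ℕ) (g g' : ℕ → ℝ),
          0 < C → 0 < θ → θ < 1 → 0 < γ → C * γ ^ 3 ≤ 3 / 2 → HistLipschitz Λ γ S.β → FadingMemory C θ Λ →
          RGEqH K S.β g → RGEqH K S.β g' →
          (∀ i, i ≤ K → 0 < g i ∧ g i ≤ γ) → (∀ i, i ≤ K → 0 < g' i ∧ g' i ≤ γ) →
          g K = g' K → g K ≤ e₀ C θ γ → ∀ j, j ≤ K → g j = g' j) := by
  rintro ⟨e₀, he₀, h⟩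
  have he : 0 < e₀ (3 / 2) (1 / 2) 1 := he₀ (3 / 2) (1 / 2) 1 (by norm_num) (by norm_num) (by norm_num) one_pos
  -- a depth K with 1∕√(K − 1) ≤ e₀
  obtain ⟨K, hK⟩ := exists_nat_ge (1 / (e₀ (3 / 2) (1 / 2) 1) ^ 2 + 2)
  have hKr : (2 : ℝ) ≤ K := le_trans (by linarith [(by positivity : (0 : ℝ) ≤ 1 / (e₀ (3 / 2) (1 / 2) 1) ^ 2)]) hK
  have hK2 : 2 ≤ K := by exact_mod_cast hKr
  obtain ⟨S, Λ, g, g', hL, hΛ, hg, hg', hbox, hbox', hpin, hend, hne⟩ := memoryFold_twoRuns K hK2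
  have hsmall : g K ≤ e₀ (3 / 2) (1 / 2) 1 := by
    rw [hend]
    have hKpos : (0 : ℝ) < (K : ℝ) - 1 := by linarith
    have h1 : 1 / (e₀ (3 / 2) (1 / 2) 1) ^ 2 ≤ (K : ℝ) - 1 := by linarith
    rw [div_le_iff₀ (Real.sqrt_pos.mpr hKpos)]
    have h2 : 1 / e₀ (3 / 2) (1 / 2) 1 ≤ Real.sqrt ((K : ℝ) - 1) := by
      rw [← Real.sqrt_sq (le_of_lt (one_div_pos.mpr he))]
      exact Real.sqrt_le_sqrt (by rw [one_div_pow]; exact h1)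
    calc (1 : ℝ) = e₀ (3 / 2) (1 / 2) 1 * (1 / e₀ (3 / 2) (1 / 2) 1) := by field_simp
      _ ≤ e₀ (3 / 2) (1 / 2) 1 * Real.sqrt ((K : ℝ) - 1) := mul_le_mul_of_nonneg_left h2 he.le
  exact hne (h S 1 (3 / 2) (1 / 2) Λ K g g' (by norm_num) (by norm_num) (by norm_num) one_pos (by norm_num) hL hΛ
    hg hg' hbox hbox' hpin hsmall 0 (Nat.zero_le K))

end

end Summit.QuantumFields.BalabanUV.Beta.EriceFlowEnclosureB12AsPrintedHistoryContagionMemoryFold
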